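/-
Copyright (c) 2026 the pub-hodgecm-mathlib formalisation cell (harness21).  Prover seat hodgecm-mathlib-K2E1b-p13 (g0),
Track B «K2-LIT» ∕ h413 (stmt-HodgeConjecture-24833), line K2_E1b «GKCohomologyU21», assembly file #19 (FIRST RUNG of the line):
payment of the tier-0 stub «WIGNER» `K2E1bGKCohomologyU21.stub_wigner` — A χ-PINNED CLASS WITH `(κ, e) ≠ (0, 0)` HAS NO `H¹_{±1}`.
Dealt BY NAME by K2E1b-plan (g0) 2026-09-03T21:08:09Z (cert `K2/K2E1b-plan/g0/K2E1bWignerAssembly.cand.K2E1b-plan-g0.lean` 673bc5dfef887cb7).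
-/
import Summits.HodgeConjecture.HodgeConjecture.Theorems.K2E1bGKCohomologyU21Defs       -- ★ defs leaf #1 (p854739): `IsChiPinnedCohUnitary`, `NoDegOneClass`, `HasChiScalars`; ★ W1∕W2 via its imports
import Summits.HodgeConjecture.HodgeConjecture.Theorems.K2E1bTypeClassesBotTransport   -- ★ #15 (p854766): `typeClassesBotTransport`
import HarnessLib

/-!
# K2_E1b road (h413 = stmt-HodgeConjecture-24833), assembly #19 «WIGNER»:
# a class pinned in χ-currency at `(κ, e) ≠ (0, 0)` carries no degree-one cohomology of type `±1`

Cell `pub/hodgecm-mathlib` (D-0151), Track B (21-frontier RULING «PUSH BOTH» 2026-09-03, director req621∕req624, chair K2-lead,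
dealer K2E1b-plan), tier-0 line `Summits/HodgeConjecture/HodgeConjecture/Cruxes/H413/Lines/K2_E1b_GKCohomologyU21.lean`
(planner K2E1b-plan (g0), sha16 026b0e9de0564551), stub **`stub_wigner`** (:182, size M, SIGS TABLE row #19, FIRST RUNG of the line):
for a class `x : GKIrrClass U(2,1)` that is χ-PINNED at `(κ, e)` (★ `IsChiPinnedCohUnitary x κ e`: SOME bundled representative `r` is an
irreducible cohomologically-unitary `(𝔲(2,1), K)`-module on which the trace-form Casimir ★ `upqCasimirOp` acts by `κ` and every central
`Z = i·1 ∈ 𝔲(2,1)` acts by `e·i`, ★ `HasChiScalars`) with `κ ≠ 0 ∨ e ≠ 0`, EVERY irreducible module `(M, σK, σ𝔤)` of class `x` has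
`H¹_δ(𝔲(2,1), K; M) = 0` for `δ = ±1` (★ `NoDegOneClass x`).  The tier-0 predicates are the ★ defs-leaf constants
`…Cruxes.H413.K2E1bGKCohomologyU21.{IsChiPinnedCohUnitary, NoDegOneClass}` (p854739) — the FQNs tier 0 ED. 2 resolves to.

THE MATHEMATICS (Wigner's lemma in the tree's currency; Borel–Wallach I Thm. 5.3 (ii) ∕ II Cor. 3.3).
* On the pinned representative `r`: if `κ ≠ 0`, THE Casimir acts by the non-zero scalar `κ`, so `H^•(𝔤, K; r) = 0` and in particular every
  Hodge piece `H^n_δ(r) = ⊥` — ★ W1 `upqTypeClasses_eq_bot_of_upqCasimirOp_eq_smul` (II Cor. 3.3, vanishing half, NO unitarity needed);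
  if `e ≠ 0`, the central element `Z = i·1` acts by the non-zero scalar `e·i`, and a central element acting by a non-zero scalar kills
  all relative cohomology — ★ W2 `upqTypeClasses_eq_bot_of_I_smul_one_eq_smul` (I Thm. 5.3 (ii) frame: the infinitesimal character of `r`
  differs from that of the trivial coefficient module).  (Unitarity, carried by `IsChiPinnedCohUnitary`, is not used — honest surplus of the pin.)
* Transport to the whole class: any `(M, σK, σ𝔤)` with ★ `GKIrrClass.ofModule M σK σ𝔤 hM hirr = x = GKIrrClass.mk r` is `mk` of the bundle
  `⟨M, σK, σ𝔤, hM, hirr⟩` (★ `GKIrrClass.ofModule_eq_mk`, definitional), so ★ #15 `typeClassesBotTransport r ⟨M, …⟩` (class equality ⇒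
  `(𝔤, K)`-equivalence ⇒ `H^n_δ` isomorphic, ★ `UpqTypeFunctoriality`) carries `H¹_δ(r) = ⊥` to `H¹_δ(M) = ⊥`.
* §1 `upqTypeClasses_eq_bot_of_hasChiScalars` — the representative-level vanishing at every `(n, δ)` (W1 ∨ W2), reusable by #21.
* §2 **`wignerAssembly`** — tier-0 `stub_wigner` TOKEN FOR TOKEN (by-name cert: K2E1b-plan's `stub_wigner_of_transport (h15 := …) : type_of% @stub_wigner`).
No hypothesis is idle except the unitarity inside the pin (see above): drop `κ ≠ 0 ∨ e ≠ 0` and the statement fails at `x = archDegOneClass δ`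
(pinned at `(0, 0)`, ★ `archDegOneClass_spec`: `H¹_δ ≠ 0`); `NoDegOneClass x` quantifies over honest data (non-vacuous: `x = mk r` itself).

HONEST LABEL: HC_CM is proved only modulo the 7 printed citations (2 remaining named inputs: hLiu418 = stmt-HodgeConjecture-24832,
h413 = stmt-HodgeConjecture-24833) until rung 0 closes; this file is a `--supports stmt-HodgeConjecture-24833` helper: it pays ONE of the three
tier-0 stubs of the K2_E1b line (`archClausesLetter_of_line : ‹stub_jTable› → ‹stub_dsTable› → ‹stub_wigner› → ArchClausesLetter`) and retires
nothing by itself.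

## References
* [BorelWallach2000] A. Borel, N. Wallach, *Continuous cohomology, discrete subgroups, and representations of reductive groups*,
  2nd ed., Math. Surveys Monogr. 67, AMS (2000), I Thm. 5.3 (ii) (p. 31: «if the infinitesimal character of V differs from that of F then
  H*(𝔤,K; V ⊗ F) = 0»), II Cor. 3.3, II Thm. 4.8; I §4.3 (functoriality).
* [Rogawski1990] J. Rogawski, *Automorphic Representations of Unitary Groups in Three Variables*, Ann. of Math. Stud. 123 (1990),
  §12.3 pp. 176–178 (the packets at `∞` and their χ-data), Prop. 15.2.1 (a).
-/

set_option autoImplicit false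
-- the mandated namespace repeats the single-problem summit's segment (`HodgeConjecture.HodgeConjecture`)
set_option linter.dupNamespace false

noncomputable section

open Literature.NumberTheory.Automorphic
open Literature.RepresentationTheory.BorelWallach2000
open Literature.RepresentationTheory.KonnoKonno2007 Literature.RepresentationTheory.KonnoKonno2007.RealDualPair
open Literature.RepresentationTheory.KonnoKonno2007.RealDualPair.UForm
open Summit.HodgeConjecture.HodgeConjecture.Cruxes.H413.F0P3bLocalAPacketsDefs (G21)
open Summit.HodgeConjecture.HodgeConjecture.Cruxes.H413.K2E1bGKCohomologyU21 (HasChiScalars IsChiPinnedCohUnitary NoDegOneClass)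
open Summit.HodgeConjecture.HodgeConjecture.Cruxes.H413.K2E1bTypeClassesBotTransport (typeClassesBotTransport)

namespace Summit.HodgeConjecture.HodgeConjecture.Cruxes.H413.K2E1bWignerAssembly

/-! ## §1  On the pinned representative: χ-scalars `(κ, e) ≠ (0, 0)` kill every Hodge piece -/

/-- **W1 ∨ W2 on one module.**  A bundled irreducible `(𝔲(2,1), K)`-module `r` with χ-scalars `(κ, e)` (★ `HasChiScalars`: Casimir `= κ`,
centre `i·1 ↦ e·i`) and `κ ≠ 0 ∨ e ≠ 0` has `H^n_δ(𝔤, K; r) = 0` for every `n, δ`: ★ `upqTypeClasses_eq_bot_of_upqCasimirOp_eq_smul`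
(scalar `κ ≠ 0`) resp. ★ `upqTypeClasses_eq_bot_of_I_smul_one_eq_smul` (scalar `e·i ≠ 0`, at `Z = ⟨i·1, upq_I_smul_one_mem_lie⟩`, whose
matrix is `i·1` by `rfl`). [cite: BorelWallach2000, I Thm. 5.3 (ii); II Cor. 3.3] -/
theorem upqTypeClasses_eq_bot_of_hasChiScalars (r : GKIrrep G21) (κ e : ℤ) (hχ : HasChiScalars r.ρ𝔤 κ e) (hne : κ ≠ 0 ∨ e ≠ 0)
    (n : ℕ) (δ : ℤ) : upqTypeClasses r.ρK r.ρ𝔤 r.isGKModule.ad_compat n δ = ⊥ := by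
  rcases hne with hκ0 | he0
  · exact upqTypeClasses_eq_bot_of_upqCasimirOp_eq_smul r.ρK r.ρ𝔤 r.isGKModule.ad_compat
      (c := ((κ : ℤ) : ℂ)) (by exact_mod_cast hκ0) hχ.1 n δ
  · exact upqTypeClasses_eq_bot_of_I_smul_one_eq_smul r.ρK r.ρ𝔤 r.isGKModule.ad_compat
      (c := (e : ℂ) * Complex.I) (mul_ne_zero (by exact_mod_cast he0) Complex.I_ne_zero) (fun v => hχ.2 _ rfl v) n δ

/-! ## §2  The head -/

/-- **PAYMENT OF tier-0 `stub_wigner` («WIGNER»; `Cruxes/H413/Lines/K2_E1b_GKCohomologyU21.lean` :182, TOKEN FOR TOKEN).**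
A class `x` of irreducible `(𝔲(2,1), K)`-modules pinned in χ-currency at `(κ, e)` with `κ ≠ 0` or `e ≠ 0` carries NO degree-one cohomology of
type `±1`: the pinned representative `r` has `H¹_δ(r) = 0` by §1 (Wigner: a non-zero Casimir or central scalar kills `H^•(𝔤, K; ·)`,
Borel–Wallach I Thm. 5.3 (ii) ∕ II Cor. 3.3), and every irreducible module `(M, σK, σ𝔤)` of class `x = [r]` inherits `H¹_δ(M) = 0` along the
`(𝔤, K)`-equivalence the class equality provides (★ #15 `typeClassesBotTransport`; `GKIrrClass.ofModule … = mk ⟨M, …⟩` definitionally).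
[cite: BorelWallach2000, I Thm. 5.3 (ii); II Cor. 3.3; II Thm. 4.8] [cite: Rogawski1990, §12.3 pp. 176–178] -/
theorem wignerAssembly :
    ∀ (x : GKIrrClass (uFormGroup (Fin 2) (Fin 1))) (κ e : ℤ), IsChiPinnedCohUnitary x κ e → (κ ≠ 0 ∨ e ≠ 0) → NoDegOneClass x := by
  intro x κ e hx hne M _ _ σK σ𝔤 hM hirr hMx δ _
  obtain ⟨r, hrx, -, hχ⟩ := hx
  exact typeClassesBotTransport r ⟨M, σK, σ𝔤, hM, hirr⟩ (hrx.trans hMx.symm) 1 δ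
    (upqTypeClasses_eq_bot_of_hasChiScalars r κ e hχ hne 1 δ)

end Summit.HodgeConjecture.HodgeConjecture.Cruxes.H413.K2E1bWignerAssembly

end
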